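import Summits.HubbardSuperconductivity.HubbardSuperconductivity.Theorems.BalabanIRBirGappedPhaseReductionTemporalCoercivity
import HarnessLib

/-!
# Route BalabanIR — crux 4 `BirGappedPhaseReduction` (item `stmt-HubbardSuperconductivity-2082`):
# the one-mode Fock determinant of a two-state temporal chain

Companion of `…TemporalCoercivity.lean` (two-state transfer chains `G · diag(1, e^{-id})`,
`‖tr ∏‖ ≤ e^{-(κ/2)Σ(1 - cos d)} tr G^M`). After Lieb's particle–hole transformation, the Trotter
determinant formula (`Literature/…/BdGBondHamiltonianTrotterDeterminant`) and the gauge telescoping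
(`Literature/…/BdGNambuMatrixPhaseRotation`), the fermionic weight of a slice-constant pair-phase
history of the BdG reference factorises over momentum modes into `2 × 2` DETERMINANTS
`det(1₂ + ∏_t G_k u(δ_t))` with the Nambu phase steps `u(δ) = diag(e^{-iδ/2}, e^{+iδ/2})` and
`Σ_t δ_t = 0` (the jumps of a closed history). This file does the one-mode algebra, for an arbitrary
entrywise nonnegative `G : Matrix (Fin 2) (Fin 2) ℝ` (the gauge-fixed `e^{-a h_k}`):

* `nambuStep_eq_smul` — `diag(e^{-iδ/2}, e^{iδ/2}) = e^{-iδ/2} • diag(1, e^{-i(-δ)})`, so the chain is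
  the two-state chain of the companion file with phases `-δ_t`, times a scalar that is `1` on a
  closed history (`prod_map_smul_mul_smul`, `prod_map_cexp_halves_eq_one`);
* `det_one_add_fin_two` — `det(1 + X) = 1 + tr X + det X` on `Fin 2`;
* `det_prod_twoState_pairs` — `det ∏ = (det G)^{2k}` on a closed history (phase determinants cancel);
* **`twoState_norm_det_one_add_prod_le`** — for a closed history written as `k` phase pairs,
  `‖det(1 + ∏_σ G u(e_σ) G u(o_σ))‖ ≤ 1 + |det G|^{2k} + e^{-(κ/2) Σ_σ[(1-cos e_σ)+(1-cos o_σ)]} · tr G^{2k}`,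
  against the aligned value `det(1 + G^{2k}) = 1 + tr G^{2k} + (det G)^{2k}`
  (`det_one_add_twoState_pow`): the WHOLE phase dependence of the one-mode Fock weight sits in the
  pair sector `tr ∏`, which is temporally coercive uniformly in the number of slices; the
  phase-blind part `1 + (det G)^{2k}` is the empty/broken-pair sector (relative weight `≍ e^{-2k·aE_k}`
  for `G = e^{-ah_k}`, `det G = 1`).

`Theses`-free, no definitions; `--supports` the crux (dictionary step: temporal half of (C) in the
zero spatial mode, at the level of the actual Fock/determinant weight).
References: as in the companion file; P. G. de Gennes (1966) Ch. 4–5. [folklore]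
-/

noncomputable section

namespace Summit.HubbardSuperconductivity.HubbardSuperconductivity.Theorems

open Matrix Complex

/-! ### Scalar bookkeeping for the Nambu phase steps -/

/-- The Nambu phase step is a scalar multiple of the two-state step of the companion file:
`diag(e^{-iδ/2}, e^{+iδ/2}) = e^{-iδ/2} • diag(1, e^{-i(-δ)})`. [folklore] -/
theorem nambuStep_eq_smul (δ : ℝ) :
    (diagonal ![cexp (((-(δ / 2) : ℝ) : ℂ) * I), cexp (((δ / 2 : ℝ) : ℂ) * I)] :
      Matrix (Fin 2) (Fin 2) ℂ) =
      cexp (((-(δ / 2) : ℝ) : ℂ) * I) • diagonal ![(1 : ℂ), cexp (-(I * ((-δ : ℝ) : ℂ)))] := by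
  rw [← diagonal_smul]
  congr 1
  funext i
  fin_cases i
  · simp
  · show cexp _ = cexp _ * cexp _
    rw [← Complex.exp_add]
    congr 1
    push_cast
    ring

/-- Scalars pull out of a product of phase pairs:
`∏_σ (c_σ • A_σ)(d_σ • B_σ) = (∏_σ c_σ d_σ) • ∏_σ A_σ B_σ`. [folklore] -/
theorem prod_map_smul_mul_smul {n : Type*} [Fintype n] [DecidableEq n] {α : Type*}
    (c d : α → ℂ) (A B : α → Matrix n n ℂ) :
    ∀ ps : List α, (ps.map fun p => (c p • A p) * (d p • B p)).prod =
      (ps.map fun p => c p * d p).prod • (ps.map fun p => A p * B p).prod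
  | [] => by simp
  | p :: ps => by
    rw [List.map_cons, List.prod_cons, List.map_cons, List.prod_cons, List.map_cons, List.prod_cons,
      prod_map_smul_mul_smul c d A B ps, smul_mul_smul_comm, smul_mul_smul_comm]

/-- A product of exponentials is the exponential of the sum (list form). [folklore] -/
theorem prod_map_cexp {α : Type*} (f : α → ℂ) :
    ∀ l : List α, (l.map fun x => cexp (f x)).prod = cexp ((l.map f).sum)
  | [] => by simp
  | x :: l => by rw [List.map_cons, List.prod_cons, List.map_cons, List.sum_cons, Complex.exp_add,
      prod_map_cexp f l]

/-- Casting the sum of the phase jumps. [folklore] -/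
theorem sum_map_cast_mul (w : ℂ) :
    ∀ ps : List (ℝ × ℝ), (ps.map fun p => ((p.1 + p.2 : ℝ) : ℂ) * w).sum =
      (((ps.map fun p => p.1 + p.2).sum : ℝ) : ℂ) * w
  | [] => by simp
  | p :: ps => by
    rw [List.map_cons, List.sum_cons, List.map_cons, List.sum_cons, sum_map_cast_mul w ps]
    push_cast
    ring

/-- **On a closed history the scalars cancel**: if the jumps sum to zero,
`∏_σ e^{-ie_σ/2} e^{-io_σ/2} = 1`. [folklore] -/
theorem prod_map_cexp_halves_eq_one (ps : List (ℝ × ℝ)) (hsum : (ps.map fun p => p.1 + p.2).sum = 0) :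
    (ps.map fun p => cexp (((-(p.1 / 2) : ℝ) : ℂ) * I) * cexp (((-(p.2 / 2) : ℝ) : ℂ) * I)).prod = 1 := by
  have key : ∀ p : ℝ × ℝ, cexp (((-(p.1 / 2) : ℝ) : ℂ) * I) * cexp (((-(p.2 / 2) : ℝ) : ℂ) * I) =
      cexp (((p.1 + p.2 : ℝ) : ℂ) * (-(I / 2))) := fun p => by
    rw [← Complex.exp_add]
    congr 1
    push_cast
    ring
  simp_rw [key]
  rw [prod_map_cexp, sum_map_cast_mul, hsum, Complex.ofReal_zero, zero_mul, Complex.exp_zero]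

/-! ### `2 × 2` determinants -/

/-- `det(1 + X) = 1 + tr X + det X` for `2 × 2` matrices. [folklore] -/
theorem det_one_add_fin_two {R : Type*} [CommRing R] (X : Matrix (Fin 2) (Fin 2) R) :
    (1 + X).det = 1 + X.trace + X.det := by
  have h00 : (1 + X) 0 0 = 1 + X 0 0 := by simp
  have h11 : (1 + X) 1 1 = 1 + X 1 1 := by simp
  have h01 : (1 + X) 0 1 = X 0 1 := by simp
  have h10 : (1 + X) 1 0 = X 1 0 := by simp
  rw [det_fin_two, det_fin_two, trace_fin_two, h00, h11, h01, h10]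
  ring

/-- The two-state phase step has determinant `e^{-id}`. [folklore] -/
theorem det_twoState_step (d : ℝ) :
    (diagonal ![(1 : ℂ), cexp (-(I * d))] : Matrix (Fin 2) (Fin 2) ℂ).det = cexp (-(I * d)) := by
  rw [det_diagonal, Fin.prod_univ_two]
  simp

/-- `det (G.map ofReal) = det G`. [folklore] -/
theorem det_map_ofReal' {n : Type*} [Fintype n] [DecidableEq n] (G : Matrix n n ℝ) :
    (G.map ((↑) : ℝ → ℂ)).det = ((G.det : ℝ) : ℂ) :=
  (RingHom.map_det Complex.ofRealHom G).symm

/-- Determinant of a chain of phase pairs: `det ∏_σ (G D_{-e_σ} G D_{-o_σ}) = (det G)^{2k} e^{iΣ(e+o)}`.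
[folklore] -/
theorem det_prod_twoState_pairs (G : Matrix (Fin 2) (Fin 2) ℝ) :
    ∀ ps : List (ℝ × ℝ),
      ((ps.map fun p => G.map ((↑) : ℝ → ℂ) * diagonal ![(1 : ℂ), cexp (-(I * ((-p.1 : ℝ) : ℂ)))] *
        (G.map ((↑) : ℝ → ℂ) * diagonal ![(1 : ℂ), cexp (-(I * ((-p.2 : ℝ) : ℂ)))])).prod).det =
      ((G.det : ℝ) : ℂ) ^ (2 * ps.length) * cexp ((((ps.map fun p => p.1 + p.2).sum : ℝ) : ℂ) * I)
  | [] => by simp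
  | p :: ps => by
    rw [List.map_cons, List.prod_cons, det_mul, det_prod_twoState_pairs G ps, det_mul, det_mul,
      det_mul, det_twoState_step, det_twoState_step, List.length_cons, List.map_cons, List.sum_cons,
      det_map_ofReal']
    have e : cexp (-(I * ((-p.1 : ℝ) : ℂ))) * cexp (-(I * ((-p.2 : ℝ) : ℂ))) *
        cexp ((((ps.map fun p => p.1 + p.2).sum : ℝ) : ℂ) * I) =
        cexp ((((p.1 + p.2) + (ps.map fun p => p.1 + p.2).sum : ℝ) : ℂ) * I) := by
      rw [← Complex.exp_add, ← Complex.exp_add]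
      congr 1
      push_cast
      ring
    rw [← e]
    ring

/-- **On a closed history the phase determinants cancel**: `det ∏ = (det G)^{2k}`. [folklore] -/
theorem det_prod_twoState_pairs_of_sum_eq_zero (G : Matrix (Fin 2) (Fin 2) ℝ) (ps : List (ℝ × ℝ))
    (hsum : (ps.map fun p => p.1 + p.2).sum = 0) :
    ((ps.map fun p => G.map ((↑) : ℝ → ℂ) * diagonal ![(1 : ℂ), cexp (-(I * ((-p.1 : ℝ) : ℂ)))] *
        (G.map ((↑) : ℝ → ℂ) * diagonal ![(1 : ℂ), cexp (-(I * ((-p.2 : ℝ) : ℂ)))])).prod).det =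
      ((G.det : ℝ) : ℂ) ^ (2 * ps.length) := by
  rw [det_prod_twoState_pairs, hsum, Complex.ofReal_zero, zero_mul, Complex.exp_zero, mul_one]

/-! ### The one-mode Fock determinant -/

/-- **The aligned value.** `det(1 + G^{2k}) = 1 + tr G^{2k} + (det G)^{2k}` — the one-mode Fock
weight of the phase-ALIGNED history (empty + broken-pair sector `1 + det`, pair sector `tr`).
[folklore] -/
theorem det_one_add_twoState_pow (G : Matrix (Fin 2) (Fin 2) ℝ) (k : ℕ) :
    (1 + (G.map ((↑) : ℝ → ℂ) * G.map ((↑) : ℝ → ℂ)) ^ k).det =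
      1 + ((((G * G) ^ k).trace : ℝ) : ℂ) + ((G.det : ℝ) : ℂ) ^ (2 * k) := by
  have hmul : G.map ((↑) : ℝ → ℂ) * G.map ((↑) : ℝ → ℂ) = (G * G).map ((↑) : ℝ → ℂ) :=
    (Matrix.map_mul (L := G) (M := G) (f := Complex.ofRealHom)).symm
  have hpow : ((G * G).map ((↑) : ℝ → ℂ)) ^ k = ((G * G) ^ k).map ((↑) : ℝ → ℂ) :=
    (Matrix.map_pow (G * G) Complex.ofRealHom k).symm
  rw [det_one_add_fin_two, hmul, hpow, det_map_ofReal', det_pow, det_mul, ← sq, ← pow_mul,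
    trace_fin_two, trace_fin_two, Matrix.map_apply, Matrix.map_apply]
  push_cast
  ring

/-- **Temporal coercivity of the one-mode Fock determinant.** For an entrywise nonnegative
two-state transfer matrix `G`, `0 ≤ κ` below the four conditional variances (companion file), and a
CLOSED slice-phase history written as `k` pairs of Nambu phase steps
`u(δ) = diag(e^{-iδ/2}, e^{+iδ/2})` with `Σ_σ (e_σ + o_σ) = 0`:
`‖det(1 + ∏_σ G u(e_σ) G u(o_σ))‖ ≤ 1 + |det G|^{2k} + e^{-(κ/2) Σ_σ[(1 - cos e_σ) + (1 - cos o_σ)]} · tr G^{2k}`.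
Compared with the aligned value `1 + tr G^{2k} + (det G)^{2k}` (`det_one_add_twoState_pow`): the
entire phase dependence is in the pair sector and is coercive uniformly in `k`. [folklore] -/
theorem twoState_norm_det_one_add_prod_le (G : Matrix (Fin 2) (Fin 2) ℝ) (hG : ∀ i j, 0 ≤ G i j)
    {κ : ℝ} (hκ0 : 0 ≤ κ)
    (hκ : ∀ b b' : Fin 2, κ * (G b 0 * G 0 b' + G b 1 * G 1 b') ^ 2 ≤ (G b 0 * G 0 b') * (G b 1 * G 1 b'))
    (ps : List (ℝ × ℝ)) (hsum : (ps.map fun p => p.1 + p.2).sum = 0) :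
    ‖(1 + (ps.map fun p =>
        G.map ((↑) : ℝ → ℂ) * diagonal ![cexp (((-(p.1 / 2) : ℝ) : ℂ) * I), cexp (((p.1 / 2 : ℝ) : ℂ) * I)] *
        (G.map ((↑) : ℝ → ℂ) *
          diagonal ![cexp (((-(p.2 / 2) : ℝ) : ℂ) * I), cexp (((p.2 / 2 : ℝ) : ℂ) * I)])).prod).det‖ ≤
      1 + |G.det| ^ (2 * ps.length) +
        Real.exp (-(κ / 2 * (ps.map fun p => (1 - Real.cos p.1) + (1 - Real.cos p.2)).sum)) *
          ((G * G) ^ ps.length).trace := by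
  set Gc : Matrix (Fin 2) (Fin 2) ℂ := G.map ((↑) : ℝ → ℂ) with hGc
  -- the chain in two-state form, phases `-e_σ, -o_σ`
  set P : Matrix (Fin 2) (Fin 2) ℂ := (ps.map fun p =>
      Gc * diagonal ![(1 : ℂ), cexp (-(I * ((-p.1 : ℝ) : ℂ)))] *
        (Gc * diagonal ![(1 : ℂ), cexp (-(I * ((-p.2 : ℝ) : ℂ)))])).prod with hP
  have hprod : (ps.map fun p =>
      Gc * diagonal ![cexp (((-(p.1 / 2) : ℝ) : ℂ) * I), cexp (((p.1 / 2 : ℝ) : ℂ) * I)] *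
        (Gc * diagonal ![cexp (((-(p.2 / 2) : ℝ) : ℂ) * I), cexp (((p.2 / 2 : ℝ) : ℂ) * I)])).prod = P := by
    have h1 : (fun p : ℝ × ℝ =>
        Gc * diagonal ![cexp (((-(p.1 / 2) : ℝ) : ℂ) * I), cexp (((p.1 / 2 : ℝ) : ℂ) * I)] *
          (Gc * diagonal ![cexp (((-(p.2 / 2) : ℝ) : ℂ) * I), cexp (((p.2 / 2 : ℝ) : ℂ) * I)])) =
        fun p => (cexp (((-(p.1 / 2) : ℝ) : ℂ) * I) • (Gc * diagonal ![(1 : ℂ), cexp (-(I * ((-p.1 : ℝ) : ℂ)))])) *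
          (cexp (((-(p.2 / 2) : ℝ) : ℂ) * I) • (Gc * diagonal ![(1 : ℂ), cexp (-(I * ((-p.2 : ℝ) : ℂ)))])) := by
      funext p
      rw [nambuStep_eq_smul, nambuStep_eq_smul, Matrix.mul_smul, Matrix.mul_smul]
    rw [h1, prod_map_smul_mul_smul, prod_map_cexp_halves_eq_one ps hsum, one_smul]
  -- the three sectors
  have htr : ‖P.trace‖ ≤ Real.exp (-(κ / 2 * (ps.map fun p => (1 - Real.cos p.1) + (1 - Real.cos p.2)).sum)) *
      ((G * G) ^ ps.length).trace := by
    have h := twoState_norm_trace_prod_le G hG hκ0 hκ (ps.map fun p : ℝ × ℝ => (-p.1, -p.2))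
    rw [List.map_map, List.map_map, List.length_map] at h
    have hcos : ((fun p : ℝ × ℝ => (1 - Real.cos p.1) + (1 - Real.cos p.2)) ∘ fun p : ℝ × ℝ => (-p.1, -p.2)) =
        fun p : ℝ × ℝ => (1 - Real.cos p.1) + (1 - Real.cos p.2) := by
      funext p
      simp only [Function.comp_apply, Real.cos_neg]
    rw [hcos] at h
    exact h
  have hdet : ‖P.det‖ = |G.det| ^ (2 * ps.length) := by
    rw [hP, det_prod_twoState_pairs_of_sum_eq_zero G ps hsum, norm_pow, Complex.norm_real,
      Real.norm_eq_abs]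
  rw [hprod, det_one_add_fin_two]
  calc ‖1 + P.trace + P.det‖ ≤ ‖(1 : ℂ)‖ + ‖P.trace‖ + ‖P.det‖ := norm_add₃_le
    _ ≤ 1 + Real.exp (-(κ / 2 * (ps.map fun p => (1 - Real.cos p.1) + (1 - Real.cos p.2)).sum)) *
          ((G * G) ^ ps.length).trace + |G.det| ^ (2 * ps.length) := by
        rw [norm_one, hdet]
        linarith [htr]
    _ = _ := by ring

end Summit.HubbardSuperconductivity.HubbardSuperconductivity.Theorems
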